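import Mathlib
import Summits.QuantumFields.BalabanUV.Beta.CoarseCoerciveQuasiReconstruction

/-!
# [Balaban1985BackgroundPropagators] (3.19) p. 393 «(Q′_j(U)λ)(y) = Σ_{x∈B^j(y)} L^{−jd}R(U(Γ^{(j)}_{y,x}))λ(x)» — ISOMETRIC
# FIBRE TRANSPORTS DROP OUT OF THE MASS MATRIX OF IN-BLOCK BUMPS: for the covariant block average (scalar block weights
# `s_y(x)` times an orthogonal transport `R_y(x)` on the fibre) and the covariant quasi-reconstruction (scalar in-block
# profile `t_y(x)` times the SAME transport), the mass matrix of `CoarseCoerciveQuasiReconstruction` is the U = 1 scalar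
# one `Σ_x t_y(x)s_y(x)` ⊗ `1_fibre` — leaf (m) of NOTE-I3 §5.2 in kernel form: NO regularity of the background field is
# needed for the MASS side of E-I3 (cell topic `Summits/QuantumFields/BalabanUV/Beta`; row-D4 interface item (I3), E-I3)

HONEST FRAMING (cell rule).  Discharging `BetaPertH` makes Bałaban's UV stability UNCONDITIONAL — a real constructive-QFT
result; NOT the continuum limit, NOT the Clay problem.  This module discharges NOTHING of `BetaPertH`.  [folklore] algebra
(`R·Rᵀ = 1`), kernel-checked.  WHY: NOTE-I3 v1.1 §5.2 (`HOME/b2b-balaban-beta-an4/g39/NOTE-I3-coarse-coercivity.md`) splits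
E-I3 for Bałaban's covariant averaging (3.19) into (m) the mass matrix, (e1) the slope part and (e2) the thin-loop
holonomy part of the energy; (e1)∕(e2) need the covariant derivative and regularity (3.35) — O.2-level —, but (m) is pure
algebra: with IN-BLOCK profiles (bumps of different blocks have disjoint supports, as in `CoarseCoerciveBlock1D`) and the
SAME isometric transport in the bump and in the average, the transports cancel (`Σ_i R_{ai}R_{a′i} = δ_{aa′}`) and the mass
matrix is the scalar U = 1 one, DIAGONAL in the block AND in the fibre index — so the mass coercivity `c` of
`sandwich_coercive_of_quasiReconstruction` is the U = 1 number for EVERY background field.  Abstract over: sites `S`,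
fibre `Cp`, blocks `μ`; scalar weights `s` (average) and `t` (profile) with disjoint block supports; transports
`R : μ → S → Matrix Cp Cp ℝ` with `R·Rᵀ = 1`.  Nothing of Bałaban's operators is instantiated (which `R` = `R(U(Γ_{y,x}))`
is the instance's business); NO class change on any GAPS row; readiness width 0 unchanged; NOT summit progress.  Unit
`b2b-balaban-beta-an4-g39` (owner lineage of `BINDER-OWNERS.md` row D4); `GAPS.md` C-an4-113.

CITATION HEADER (lean-in-tree rule).  [13] = T. Bałaban, *Propagators for lattice gauge theories in a background field*,
Commun. Math. Phys. **99**, 389–434 (1985) [Balaban1985BackgroundPropagators], p. 393 [PDF 5] (render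
`HOME/b2b-balaban-ref1/pages/1985-cmp99-background-propagators/…-p005-x2.png`, READ AS IMAGE 2026-08-20), (3.19) verbatim:
*"(Q′_j(U)λ)(y) = (Q′(Ū^{j−1})·…·Q′(Ū)Q′(U)λ)(y) = Σ_{x∈B^j(y)} L^{−jd}R(U(Γ^{(j)}_{y,x}))λ(x), y ∈ T^{(j)}_{L^jη}. The contours
Γ^{(j)}_{y,x}, x ∈ B^j(y), and the contour variables U(Γ^{(j)}_{y,x}) were defined by (52), (53) in [5]."*  LOCATOR only;
nothing printed is asserted.

WHAT IS CERTIFIED HERE (kernel, sorry-free; [folklore]).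
§1 `covFamily` (scalar weight × transport, as complex test vectors on `S × Cp` indexed by `μ × Cp`),
   **`massMatrix_covFamily`** (disjoint block supports + `R·Rᵀ = 1` ⟹ mass matrix `((y,a),(y′,a′)) ↦ [y = y′][a = a′]·Σ_x t_y(x)s_y(x)`),
   `massMatrix_covFamily_isHermitian`, **`massCoercive_covFamily`** (if `Σ_x t_y(x)s_y(x) ≥ δ` for every block then the mass
   coercivity of `sandwich_coercive_of_quasiReconstruction` holds with `c = δ`, for EVERY transport field).
§2 Non-vacuity (one site, one block, trivial fibre).
NOT CLAIMED.  The energy side (e1)∕(e2) of NOTE-I3 §5.2 (covariant derivative, (3.35)); any instance.  NOT summit progress.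
PRIOR ART IN THE TREE (searched 2026-08-20: `lean search 'massMatrix|covMean|transport.*mass'`): `CoarseCoerciveQuasi
Reconstruction.massMatrix`∕`massCoercive_of_diagDominant` (scalar); pv21 `B9Thm37GlueTorusCov.covMean`∕`Comb.tr` (the
MODEL's covariant means — an instance supplier of `R`, not used here); `CoarseCoerciveBlock1D.massMatrix_bump_bmean` (U = 1).
-/

namespace Summit.QuantumFields.BalabanUV.Beta.CoarseCoerciveTransport

open scoped BigOperators Matrix ComplexConjugate
open Finset Matrix
open Summit.QuantumFields.BalabanUV.Beta.UnitLatticeResolventWalk (Qm superpose)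
open Summit.QuantumFields.BalabanUV.Beta.CoarseCoerciveQuasiReconstruction (massMatrix star_superpose_dotProduct_eq)
open Literature.MathematicalPhysics.QuantumFieldTheory.Balaban1983to89.B5Prop11Lower (nsq nsq_nonneg star_dotProduct_self)

noncomputable section

variable {S Cp μ : Type*} [Fintype S] [Fintype Cp] [Fintype μ] [DecidableEq S] [DecidableEq Cp] [DecidableEq μ]

/-! ## §1 Transports drop out of the mass matrix -/

/-- A COVARIANT TEST-VECTOR FAMILY on the fibred fine index `S × Cp`, indexed by the fibred coarse index `μ × Cp`: scalar
weight `f_y(x)` times the transport `R_y(x)` (row `a`, component `i`). [folklore] -/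
def covFamily (f : μ → S → ℝ) (R : μ → S → Matrix Cp Cp ℝ) : μ × Cp → S × Cp → ℂ :=
  fun ya xi => ((f ya.1 xi.1 * R ya.1 xi.1 ya.2 xi.2 : ℝ) : ℂ)

omit [Fintype μ] [DecidableEq S] in
/-- **TRANSPORTS DROP OUT**: with scalar profile `t` and scalar average weights `s` of DISJOINT block supports
(`t_y(x)·s_{y′}(x) = 0` for `y ≠ y′`) and the SAME transport `R` with `R_y(x)·R_y(x)ᵀ = 1`, the mass matrix of the covariant
families is `[y = y′]·[a = a′]·Σ_x t_y(x)s_y(x)` — the U = 1 scalar mass matrix ⊗ `1`. [cite: Balaban1985BackgroundPropagators, (3.19) p.393] -/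
theorem massMatrix_covFamily (t s : μ → S → ℝ) (hdisj : ∀ y y' x, y ≠ y' → t y x * s y' x = 0)
    (R : μ → S → Matrix Cp Cp ℝ) (hR : ∀ y x, R y x * (R y x)ᵀ = 1) (y : μ) (a : Cp) (y' : μ) (a' : Cp) :
    massMatrix (covFamily t R) (covFamily s R) (y, a) (y', a') =
      if y = y' ∧ a = a' then ((∑ x, t y x * s y x : ℝ) : ℂ) else 0 := by
  rw [massMatrix, Matrix.mul_apply]
  simp only [Qm, Matrix.conjTranspose_apply, covFamily, Complex.star_def, Complex.conj_ofReal]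
  rw [Fintype.sum_prod_type]
  simp only [← Complex.ofReal_mul, ← Complex.ofReal_sum]
  by_cases hy : y = y'
  · subst hy
    have hfib : ∀ x, ∑ i, t y x * R y x a i * (s y x * R y x a' i) = t y x * s y x * (if a = a' then 1 else 0) := by
      intro x
      have hRR := congrFun (congrFun (hR y x) a) a'
      rw [Matrix.mul_apply, Matrix.one_apply] at hRR
      simp only [Matrix.transpose_apply] at hRR
      rw [← hRR, Finset.mul_sum]
      exact Finset.sum_congr rfl fun i _ => by ring
    simp only [hfib, true_and]
    by_cases ha : a = a'
    · rw [if_pos ha]; simp [ha]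
    · rw [if_neg ha]; simp [ha]
  · rw [if_neg (fun h => hy h.1)]
    norm_cast
    refine Finset.sum_eq_zero fun x _ => Finset.sum_eq_zero fun i _ => ?_
    have := hdisj y y' x hy
    calc t y x * R y x a i * (s y' x * R y' x a' i) = (t y x * s y' x) * (R y x a i * R y' x a' i) := by ring
      _ = 0 := by rw [this, zero_mul]

omit [Fintype μ] [DecidableEq S] in
/-- … hence it is Hermitian (a real diagonal matrix). [folklore] -/
theorem massMatrix_covFamily_isHermitian (t s : μ → S → ℝ) (hdisj : ∀ y y' x, y ≠ y' → t y x * s y' x = 0)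
    (R : μ → S → Matrix Cp Cp ℝ) (hR : ∀ y x, R y x * (R y x)ᵀ = 1) :
    (massMatrix (covFamily t R) (covFamily s R)).IsHermitian := by
  have hdiag : massMatrix (covFamily t R) (covFamily s R) =
      Matrix.diagonal fun ya : μ × Cp => ((∑ x, t ya.1 x * s ya.1 x : ℝ) : ℂ) := by
    ext ⟨y, a⟩ ⟨y', a'⟩
    rw [massMatrix_covFamily t s hdisj R hR, Matrix.diagonal_apply]
    by_cases h : y = y' ∧ a = a'
    · obtain ⟨rfl, rfl⟩ := h; simp
    · rw [if_neg h, if_neg (fun h' => h (Prod.mk.inj h'))]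
  rw [hdiag, Matrix.isHermitian_diagonal_iff]
  intro ya
  rw [isSelfAdjoint_iff, Complex.star_def, Complex.conj_ofReal]

omit [DecidableEq S] in
/-- **MASS COERCIVITY FOR EVERY TRANSPORT FIELD**: if every block has `Σ_x t_y(x)s_y(x) ≥ δ` (the U = 1 number, e.g.
`1 − 2w∕n` for the in-block plateau against the block mean), then the hypothesis `hmass` of
`CoarseCoerciveQuasiReconstruction.sandwich_coercive_of_quasiReconstruction` holds with `c = δ` for the covariant families —
whatever the isometric transports `R`. [cite: Balaban1985BackgroundPropagators, (3.19) p.393] -/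
theorem massCoercive_covFamily (t s : μ → S → ℝ) (hdisj : ∀ y y' x, y ≠ y' → t y x * s y' x = 0)
    (R : μ → S → Matrix Cp Cp ℝ) (hR : ∀ y x, R y x * (R y x)ᵀ = 1) {δ : ℝ} (hδ : ∀ y, δ ≤ ∑ x, t y x * s y x)
    (B : μ × Cp → ℂ) :
    δ * nsq B ≤ (star (superpose (covFamily t R) B) ⬝ᵥ superpose (covFamily s R) B).re := by
  have h := CoarseCoerciveQuasiReconstruction.massCoercive_of_diagDominant (covFamily t R) (covFamily s R)
    (massMatrix_covFamily_isHermitian t s hdisj R hR) (δ := δ) (σ := 0) (fun ya => ?_) (fun ya => ?_) B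
  · rwa [sub_zero] at h
  · rw [massMatrix_covFamily t s hdisj R hR, if_pos ⟨rfl, rfl⟩, Complex.ofReal_re]
    exact hδ ya.1
  · refine le_of_eq (Finset.sum_eq_zero fun yb hyb => ?_)
    obtain ⟨y', a'⟩ := yb
    rw [massMatrix_covFamily t s hdisj R hR, if_neg, norm_zero]
    rintro ⟨h1, h2⟩
    exact Finset.ne_of_mem_erase hyb (Prod.ext h1 h2).symm

/-! ## §2 Non-vacuity -/

/-- One site, one block, one-dimensional fibre, `t = s = 1`, `R = 1`: the mass matrix entry is `1` and the coercivity
`1·‖B‖² ≤ Re …` holds. [folklore] -/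
example (B : Unit × Unit → ℂ) :
    (1 : ℝ) * nsq B ≤ (star (superpose (covFamily (fun (_ : Unit) (_ : Unit) => (1 : ℝ)) fun _ _ => (1 : Matrix Unit Unit ℝ)) B)
      ⬝ᵥ superpose (covFamily (fun (_ : Unit) (_ : Unit) => (1 : ℝ)) fun _ _ => (1 : Matrix Unit Unit ℝ)) B).re :=
  massCoercive_covFamily _ _ (fun y y' _ h => (h (Subsingleton.elim y y')).elim) _ (fun _ _ => by simp)
    (fun _ => by simp) B

end

end Summit.QuantumFields.BalabanUV.Beta.CoarseCoerciveTransport
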